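import Literature.Analysis.FluidPDE.ForcedFourierDuhamelDefs
import Literature.Analysis.FluidPDE.TaoH1FourierMildFamily
import HarnessLib

/-!
# Forced Fourier-side `H¹`-mild solutions of Sobolev class: envelopes, the differential equation
# and the time-derivative families (classical half of the forced engine, file 1)

Forced twin of `TaoH1FourierMildFamily.lean`. T. Tao, *Localisation and compactness properties of
the Navier–Stokes global regularity problem*, Anal. PDE 6 (2013) 25–107 = arXiv:1108.1165,
Thm. 5.4 = arXiv Thm. 31 (p. 18) is stated and proved WITH a forcing term `f`; part (iv) and the
note closing its proof ("if `(u, p, u₀, f, T, 1)` is a `H¹` mild solution, and [the data are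
Schwartz], then `u` and `p` are smooth; in fact, one has `∂ₜʲu, ∂ₜʲp ∈ L^∞_t H^k([0, T] × ℝ³)`
for all `j, k ≥ 0`") is the CLASSICAL half of the forced engine whose EXISTENCE half (the
contraction of the forced Duhamel map `FourierNS.duhamelForced`, seat `ns-blowup-lean2`) and
whose PHYSICAL TRANSFER (the Fourier-side force of a Schwartz-on-slab physical force, seat
`ns-blowup-lit`) are the companion files. The three halves discharge the named fact
`tao2011_smooth_local_existence_forced` (`TaoH1LocalExistenceForced.lean`), the input of the
kernel theorem `localContinuationAt_of_forced_local_existence` (cell `ns-blowup`, route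
`PalasekTowerBreakdown`, child crux `HeredityAtOne`, stub `LocalContinuationAt k`).

For a heat rate `c ≥ 0`, a datum `a` of Sobolev class (`IsSobolevFourierDatum a`), projected force
coefficients `b : ℝ → E → ℂ^ι` and a forced Fourier-side mild solution `v`
(`IsSobolevMildForced c T a b v`, `ForcedFourierDuhamelDefs.lean`) we prove, mirroring the
unforced file lemma by lemma:

* `IsSobolevMildForced.exists_dom` — **square-integrable envelopes of every order**, uniformly in
  time (the structure's `decay` clause bounds `v − heat • a`, which CONTAINS the forcing term, so the
  unforced proof applies verbatim); hence `memLp_apply`, `tendsto_eLpNorm_sub` (`L²`-continuity in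
  time), `continuous_nonlin` (joint continuity of the nonlinearity), `continuous_presSymbol_time`;
* `IsSobolevMildForced.hasDerivWithinAt` — **mild ⇒ differential**: at every frequency and every
  `t ∈ [0, T]`, `∂ₜ v(t, ξ) = -c‖ξ‖² v(t, ξ) − N(v(t), v(t))(ξ) + b(t, ξ)` within `[0, T]`, for
  `b(·, ξ)` continuous on `[0, T]` (the computation `e^{-βt}(a − ∫₀ᵗ e^{βs} N ds + ∫₀ᵗ e^{βs} b ds)`
  and the fundamental theorem of calculus);
* `IsSobolevMildForced.exists_family` — **time derivatives of all orders**: given a DERIVATIVE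
  TOWER of the force (`B 0 = b`, the components of `B` square-dominated families of every order
  on `[0, T]` with `∂ₜ B_k = B_{k+1}` — the tree's `IsDomFamily`, which the physical-transfer file
  supplies for a Schwartz-on-slab force), for every `n` there is a vector family `W₀ = v, W₁, …,
  W_n` of square-dominated Fourier families with `∂ₜ W_k = W_{k+1}` within `[0, T]`, built by the
  bootstrap `W_{k+1} = -c‖ξ‖² W_k − N(W, W)_k + B_k`; and the pressure-symbol / nonlinearity
  families (`exists_presFamily`, `exists_nonlinFamily`) — for a PROJECTED (divergence-free) force
  the pressure symbol is the unforced one (the gradient part of a raw force is a gauge change of the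
  pressure, done in the synthesis file).

No definition, no named fact (theorems only; net Literature debt 0). The force hypotheses are
carried as explicit binders (`hb`, `hB0`, `hB`) so that the physical-transfer file can discharge
them in whatever packaging it lands.

## Mathlib / tree search

Reused verbatim: `norm_apply_le_norm_add_norm_sub_heat`, `IsSobolevFourierDatum.memLp_weight_mul_norm`
(`TaoH1FourierMildFamily`), `IsDomFamily` and its algebra `add`/`sub`/`symbol`/`nonlinFamily`/
`presFamily` (`NSRegFourierFamily`), `consFamily`, `norm_heatSymbol_le` (`NSFourierTimeRegularity`),
`tendsto_eLpNorm_sub_of_dominated`, `continuous_nonlin_of_tendsto`,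
`continuous_presSymbol_time_of_tendsto` (`FourierL2Trajectory`), `forcing`, `duhamelForced`,
`IsSobolevMildForced` (`ForcedFourierDuhamelDefs`). `lean search 'IsSobolevMildForced.hasDeriv'`,
`'IsSobolevMildForced.exists_family'`: no hits before this file. Mathlib:
`Continuous.integral_hasStrictDerivAt`, `HasDerivAt.smul`, `continuousOn_pi`.

## References

* T. Tao, arXiv:1108.1165 = Anal. PDE 6 (2013), Thm. 5.4 = arXiv Thm. 31 (p. 18), (iv) and the
  note closing its proof; the Duhamel formula with force (7), p. 3. [Tao2011]
* J. Leray, Acta Math. 63 (1934), §19, pp. 220–221 (the regular solution and its time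
  derivatives). [Leray1934]
-/

noncomputable section

open MeasureTheory Real Set Filter Function Complex
open scoped ENNReal NNReal ComplexConjugate
open _root_.Topology

namespace Literature.Analysis.FluidPDE.FourierNS

variable {ι : Type*} [Fintype ι] [DecidableEq ι]
variable {c T : ℝ} {a : EuclideanSpace ℝ ι → ι → ℂ} {b : ℝ → EuclideanSpace ℝ ι → ι → ℂ}
  {v : ℝ → EuclideanSpace ℝ ι → ι → ℂ}

/-! ### Envelopes of the forced mild solution -/

section Envelope

/-- **Square-integrable envelopes of every order, uniformly in time** (forced case). For `c ≥ 0`,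
a datum of Sobolev class and an `IsSobolevMildForced` solution: for every `K` and every component
`l` there is `G ∈ L²(E)` with `(1 + ‖ξ‖)^K ‖v(t, ξ)ₗ‖ ≤ G(ξ)` for all `t` and `ξ`
(`G = (1+‖ξ‖)^K ‖aₗ‖ + B_{K+K₀} (1+‖ξ‖)^{-K₀}`, `K₀ = card ι + 1`; the decay clause of the structure
bounds `v − heat • a`, forcing term included). [cite: Tao2011, Thm. 5.4 (iv) (arXiv Thm. 31)] -/
theorem IsSobolevMildForced.exists_dom (h : IsSobolevMildForced c T a b v) (hc : 0 ≤ c)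
    (ha : IsSobolevFourierDatum a) (K : ℕ) (l : ι) :
    ∃ G : EuclideanSpace ℝ ι → ℝ, MemLp G 2 volume ∧
      ∀ t ξ, (1 + ‖ξ‖) ^ K * ‖v t ξ l‖ ≤ G ξ := by
  set K₀ := Fintype.card ι + 1 with hK₀
  obtain ⟨B, hB⟩ := h.decay (K + K₀)
  refine ⟨fun ξ => (1 + ‖ξ‖) ^ K * ‖a ξ l‖ + B * ((1 + ‖ξ‖) ^ K₀)⁻¹, ?_, fun t ξ => ?_⟩
  · exact (ha.memLp_weight_mul_norm K l).add
      ((memLp_inv_one_add_norm_pow_two (ι := ι)).const_mul B)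
  · have hpos : 0 < (1 + ‖ξ‖) ^ K₀ := by positivity
    have hdec : (1 + ‖ξ‖) ^ K * ‖v t ξ - heat c ξ (clamp T t) • a ξ‖ ≤ B * ((1 + ‖ξ‖) ^ K₀)⁻¹ := by
      rw [le_mul_inv_iff₀ hpos]
      calc (1 + ‖ξ‖) ^ K * ‖v t ξ - heat c ξ (clamp T t) • a ξ‖ * (1 + ‖ξ‖) ^ K₀
          = (1 + ‖ξ‖) ^ (K + K₀) * ‖v t ξ - heat c ξ (clamp T t) • a ξ‖ := by rw [pow_add]; ring
        _ ≤ B := hB t ξ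
    calc (1 + ‖ξ‖) ^ K * ‖v t ξ l‖
        ≤ (1 + ‖ξ‖) ^ K * (‖a ξ l‖ + ‖v t ξ - heat c ξ (clamp T t) • a ξ‖) :=
          mul_le_mul_of_nonneg_left (norm_apply_le_norm_add_norm_sub_heat hc t ξ l) (by positivity)
      _ = (1 + ‖ξ‖) ^ K * ‖a ξ l‖ + (1 + ‖ξ‖) ^ K * ‖v t ξ - heat c ξ (clamp T t) • a ξ‖ := by ring
      _ ≤ (1 + ‖ξ‖) ^ K * ‖a ξ l‖ + B * ((1 + ‖ξ‖) ^ K₀)⁻¹ := add_le_add le_rfl hdec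

/-- Measurability of a component slice of a forced mild solution. [cite: Tao2011, Thm. 5.4 (iv) (arXiv Thm. 31)] -/
theorem IsSobolevMildForced.aesm_apply (h : IsSobolevMildForced c T a b v) (t : ℝ) (l : ι) :
    AEStronglyMeasurable (fun ξ => v t ξ l) volume :=
  (continuous_apply l).comp_aestronglyMeasurable (h.meas t)

/-- **The components of a forced mild solution form square-dominated families of order `0`.**
[cite: Tao2011, Thm. 5.4 (iv) (arXiv Thm. 31)] -/
theorem IsSobolevMildForced.isDomFamily_zero (h : IsSobolevMildForced c T a b v) (hc : 0 ≤ c)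
    (ha : IsSobolevFourierDatum a) (l : ι) :
    IsDomFamily T 0 (fun _ t ξ => v t ξ l) where
  meas _ _ t _ := h.aesm_apply t l
  dom _ _ K := by
    obtain ⟨G, hG, hle⟩ := h.exists_dom hc ha K l
    exact ⟨G, hG, fun t _ ξ => hle t ξ⟩
  cont _ _ ξ := ((continuous_apply l).comp (h.cont ξ)).continuousOn
  deriv k hk := absurd hk (Nat.not_lt_zero k)

/-- **Components of a forced mild solution are square integrable** at every time.
[cite: Tao2011, Thm. 5.4 (iv) (arXiv Thm. 31)] -/
theorem IsSobolevMildForced.memLp_apply (h : IsSobolevMildForced c T a b v) (hc : 0 ≤ c)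
    (ha : IsSobolevFourierDatum a) (t : ℝ) (l : ι) : MemLp (v t · l) 2 volume := by
  obtain ⟨G, hG, hle⟩ := h.exists_dom hc ha 0 l
  refine MemLp.of_le (hG.norm) (h.aesm_apply t l) (Eventually.of_forall fun ξ => ?_)
  have := hle t ξ
  rw [pow_zero, one_mul] at this
  rw [norm_norm, Real.norm_eq_abs, abs_of_nonneg ((norm_nonneg _).trans this)]
  exact this

/-- **`L²`-continuity in time of the components** of a forced mild solution (dominated
convergence: pointwise continuity in `t` and the square-integrable envelope of order `0`).
[cite: Tao2011, Thm. 5.4 (iv) (arXiv Thm. 31)] -/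
theorem IsSobolevMildForced.tendsto_eLpNorm_sub (h : IsSobolevMildForced c T a b v) (hc : 0 ≤ c)
    (ha : IsSobolevFourierDatum a) (l : ι) (s₀ : ℝ) :
    Tendsto (fun s => eLpNorm ((v s · l) - (v s₀ · l)) 2 volume) (𝓝 s₀) (𝓝 0) := by
  obtain ⟨G, hG, hle⟩ := h.exists_dom hc ha 0 l
  have hfin : ∫⁻ η, ‖G η‖ₑ ^ 2 ≠ ⊤ := by
    rw [lintegral_enorm_sq_eq_eLpNorm_sq]
    exact (ENNReal.pow_lt_top hG.eLpNorm_lt_top).ne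
  refine tendsto_eLpNorm_sub_of_dominated (G := fun s => (v s · l)) (fun s => h.aesm_apply s l)
    (fun η => ‖G η‖ₑ) (fun s η => ?_) hfin (fun η => (continuous_apply l).comp (h.cont η)) s₀
  have h1 := hle s η
  rw [pow_zero, one_mul] at h1
  rw [← ofReal_norm, ← ofReal_norm, Real.norm_eq_abs, abs_of_nonneg ((norm_nonneg _).trans h1)]
  exact ENNReal.ofReal_le_ofReal h1

/-- **Joint continuity of the nonlinearity** `(s, ξ) ↦ N(v s, v s)(ξ)` on `ℝ × E` along a forced
mild solution (`continuous_nonlin_of_tendsto` of `FourierL2Trajectory`). [cite: Tao2011, Thm. 5.4 (iv) (arXiv Thm. 31)] -/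
theorem IsSobolevMildForced.continuous_nonlin (h : IsSobolevMildForced c T a b v) (hc : 0 ≤ c)
    (ha : IsSobolevFourierDatum a) :
    Continuous fun p : ℝ × EuclideanSpace ℝ ι => nonlin (v p.1) (v p.1) p.2 :=
  continuous_nonlin_of_tendsto (fun s j => h.memLp_apply hc ha s j) (fun s j => h.memLp_apply hc ha s j)
    (fun j s₀ => h.tendsto_eLpNorm_sub hc ha j s₀) (fun j s₀ => h.tendsto_eLpNorm_sub hc ha j s₀)

/-- Continuity in time of the nonlinearity at a fixed frequency (forced case). [cite: Tao2011, Thm. 5.4 (iv) (arXiv Thm. 31)] -/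
theorem IsSobolevMildForced.continuous_nonlin_time (h : IsSobolevMildForced c T a b v) (hc : 0 ≤ c)
    (ha : IsSobolevFourierDatum a) (ξ : EuclideanSpace ℝ ι) :
    Continuous fun s : ℝ => nonlin (v s) (v s) ξ :=
  (h.continuous_nonlin hc ha).comp₂ continuous_id continuous_const

/-- Continuity in time of the pressure symbol at a fixed frequency (forced case). [cite: Tao2011, Thm. 5.4 (iv) (arXiv Thm. 31)] -/
theorem IsSobolevMildForced.continuous_presSymbol_time (h : IsSobolevMildForced c T a b v)
    (hc : 0 ≤ c) (ha : IsSobolevFourierDatum a) (ξ : EuclideanSpace ℝ ι) :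
    Continuous fun s : ℝ => presSymbol (v s) (v s) ξ :=
  continuous_presSymbol_time_of_tendsto (fun s j => h.memLp_apply hc ha s j)
    (fun s j => h.memLp_apply hc ha s j) (fun j s₀ => h.tendsto_eLpNorm_sub hc ha j s₀)
    (fun j s₀ => h.tendsto_eLpNorm_sub hc ha j s₀) ξ

end Envelope

/-! ### Mild ⇒ differential (forced) -/

section Mild

omit [Fintype ι] [DecidableEq ι] in
/-- The clamped force `s ↦ b (clamp T s) ξ` is continuous on `ℝ` as soon as `b(·, ξ)` is
continuous on `[0, T]` (composition with the continuous clamp, whose range is `[0, T]` for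
`T ≥ 0`). [folklore] -/
private theorem continuous_force_clamp (hT : 0 ≤ T) {ξ : EuclideanSpace ℝ ι}
    (hb : ContinuousOn (fun t => b t ξ) (Icc 0 T)) :
    Continuous fun s => b (clamp T s) ξ :=
  hb.comp_continuous (continuous_clamp T) (fun s => clamp_mem_Icc hT s)

omit [DecidableEq ι] in
/-- On `[0, T]` the forcing term is `e^{-βt} ∫₀ᵗ e^{βσ} b(clamp σ, ξ) dσ`, `β = c‖ξ‖²` (the
clamp is the identity on the integration range). [cite: Tao2011, Duhamel formula (7) (arXiv p. 3)] -/
theorem forcing_eq_exp_smul_integral (ξ : EuclideanSpace ℝ ι) {s : ℝ}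
    (hs : s ∈ Icc 0 T) :
    forcing c T b s ξ =
      Real.exp (-(c * ‖ξ‖ ^ 2) * s) •
        ∫ σ in (0 : ℝ)..s, Real.exp (c * ‖ξ‖ ^ 2 * σ) • b (clamp T σ) ξ := by
  rw [forcing_eq, clamp_of_mem hs, ← intervalIntegral.integral_smul]
  refine intervalIntegral.integral_congr fun σ hσ => ?_
  have hσ' : σ ∈ Icc 0 T := by
    rw [uIcc_of_le hs.1] at hσ
    exact ⟨hσ.1, hσ.2.trans hs.2⟩
  change heat c ξ (s - σ) • b σ ξ =
    Real.exp (-(c * ‖ξ‖ ^ 2) * s) • (Real.exp (c * ‖ξ‖ ^ 2 * σ) • b (clamp T σ) ξ)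
  rw [clamp_of_mem hσ', smul_smul, heat, ← Real.exp_add]
  congr 1; ring_nf

/-- **Mild ⇒ differential (forced).** An `IsSobolevMildForced` solution whose force is continuous
in time on `[0, T]` at the frequency `ξ` satisfies, at every `t ∈ [0, T]`,
`∂ₜ v(t, ξ) = -c‖ξ‖² v(t, ξ) − N(v(t), v(t))(ξ) + b(t, ξ)` as a derivative within `[0, T]`
(differentiate `v(t) = e^{-βt} a − e^{-βt} ∫₀ᵗ e^{βs} N(s) ds + e^{-βt} ∫₀ᵗ e^{βs} b(s) ds`,
`β = c‖ξ‖²`, by the product rule and the fundamental theorem of calculus; Tao's `H¹` mild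
solution "obeys the Duhamel formula (7)", equivalently the projected equation (8), arXiv p. 6).
[cite: Tao2011, Thm. 5.4 (iv) (arXiv Thm. 31) and (7)–(8)] -/
theorem IsSobolevMildForced.hasDerivWithinAt (h : IsSobolevMildForced c T a b v) (hc : 0 ≤ c)
    (hT : 0 ≤ T) (ha : IsSobolevFourierDatum a) (ξ : EuclideanSpace ℝ ι)
    (hb : ContinuousOn (fun t => b t ξ) (Icc 0 T)) {t : ℝ} (ht : t ∈ Icc 0 T) :
    HasDerivWithinAt (fun s => v s ξ)
      (-(c * ‖ξ‖ ^ 2) • v t ξ - nonlin (v t) (v t) ξ + b t ξ) (Icc 0 T) t := by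
  set β := c * ‖ξ‖ ^ 2 with hβ
  set N : ℝ → ι → ℂ := fun s => nonlin (v s) (v s) ξ with hN
  have hNc : Continuous N := h.continuous_nonlin_time hc ha ξ
  -- the clamped force, continuous on `ℝ`
  set bc : ℝ → ι → ℂ := fun s => b (clamp T s) ξ with hbc
  have hbcc : Continuous bc := continuous_force_clamp hT hb
  -- `G s = ∫₀ˢ e^{βσ} N(σ) dσ`, `H s = ∫₀ˢ e^{βσ} b(σ) dσ` and their derivatives
  set G : ℝ → ι → ℂ := fun s => ∫ σ in (0 : ℝ)..s, Real.exp (β * σ) • N σ with hG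
  have hGi : Continuous fun σ => Real.exp (β * σ) • N σ :=
    (Real.continuous_exp.comp (continuous_const.mul continuous_id)).smul hNc
  have hG' : ∀ s, HasDerivAt G (Real.exp (β * s) • N s) s := fun s =>
    (hGi.integral_hasStrictDerivAt 0 s).hasDerivAt
  set H : ℝ → ι → ℂ := fun s => ∫ σ in (0 : ℝ)..s, Real.exp (β * σ) • bc σ with hH
  have hHi : Continuous fun σ => Real.exp (β * σ) • bc σ :=
    (Real.continuous_exp.comp (continuous_const.mul continuous_id)).smul hbcc
  have hH' : ∀ s, HasDerivAt H (Real.exp (β * s) • bc s) s := fun s =>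
    (hHi.integral_hasStrictDerivAt 0 s).hasDerivAt
  have hheat : ∀ s, heat c ξ s = Real.exp (-β * s) := fun s => by simp [heat, hβ]
  have hE' : ∀ s, HasDerivAt (fun s => Real.exp (-β * s)) (-β * Real.exp (-β * s)) s := fun s => by
    have := ((hasDerivAt_id s).const_mul (-β)).exp
    simpa [mul_comm] using this
  have hone : ∀ s, Real.exp (-β * s) * Real.exp (β * s) = 1 := fun s => by
    rw [← Real.exp_add]; simp
  -- `F s = e^{-βs} a − e^{-βs} G s + e^{-βs} H s` is the forced Duhamel formula
  set F : ℝ → ι → ℂ := fun s =>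
    Real.exp (-β * s) • a ξ - Real.exp (-β * s) • G s + Real.exp (-β * s) • H s with hF
  have hF' : ∀ s, HasDerivAt F (-β • F s - N s + bc s) s := by
    intro s
    have h1 : HasDerivAt (fun s => Real.exp (-β * s) • a ξ) ((-β * Real.exp (-β * s)) • a ξ) s :=
      (hE' s).smul_const _
    have h2 : HasDerivAt (fun s => Real.exp (-β * s) • G s)
        (Real.exp (-β * s) • (Real.exp (β * s) • N s) + (-β * Real.exp (-β * s)) • G s) s :=
      (hE' s).smul (hG' s)
    have h3 : HasDerivAt (fun s => Real.exp (-β * s) • H s)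
        (Real.exp (-β * s) • (Real.exp (β * s) • bc s) + (-β * Real.exp (-β * s)) • H s) s :=
      (hE' s).smul (hH' s)
    have h4 := (h1.sub h2).add h3
    have heq : (-β * Real.exp (-β * s)) • a ξ -
        (Real.exp (-β * s) • (Real.exp (β * s) • N s) + (-β * Real.exp (-β * s)) • G s) +
        (Real.exp (-β * s) • (Real.exp (β * s) • bc s) + (-β * Real.exp (-β * s)) • H s) =
        -β • F s - N s + bc s := by
      simp only [hF, smul_sub, smul_add, smul_smul, hone, one_smul]
      module
    rw [heq] at h4
    exact h4
  -- on `[0, T]`, `v s ξ = F s`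
  have hvF : ∀ s ∈ Icc 0 T, v s ξ = F s := by
    intro s hs
    rw [h.fixed s ξ, duhamelForced_eq, duhamel, clamp_of_mem hs, hheat,
      forcing_eq_exp_smul_integral ξ hs]
    have hint : (∫ σ in (0 : ℝ)..s, heat c ξ (s - σ) • nonlin (v σ) (v σ) ξ) =
        Real.exp (-β * s) • G s := by
      simp only [hG]
      rw [← intervalIntegral.integral_smul]
      refine intervalIntegral.integral_congr fun σ _ => ?_
      change heat c ξ (s - σ) • N σ = Real.exp (-β * s) • (Real.exp (β * σ) • N σ)
      rw [hheat, smul_smul, ← Real.exp_add]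
      congr 1; ring_nf
    rw [hint]
  -- at `t`, the clamped force is the force
  have hbt : bc t = b t ξ := by simp only [hbc, clamp_of_mem ht]
  have key := (hF' t).hasDerivWithinAt (s := Icc 0 T)
  rw [← hvF t ht, hbt] at key
  exact key.congr (fun s hs => hvF s hs) (hvF t ht)

/-- Componentwise form of `IsSobolevMildForced.hasDerivWithinAt`. [cite: Tao2011, Thm. 5.4 (iv) (arXiv Thm. 31) and (7)–(8)] -/
theorem IsSobolevMildForced.hasDerivWithinAt_apply (h : IsSobolevMildForced c T a b v) (hc : 0 ≤ c)
    (hT : 0 ≤ T) (ha : IsSobolevFourierDatum a) (ξ : EuclideanSpace ℝ ι)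
    (hb : ContinuousOn (fun t => b t ξ) (Icc 0 T)) {t : ℝ} (ht : t ∈ Icc 0 T) (l : ι) :
    HasDerivWithinAt (fun s => v s ξ l)
      (-((c * ‖ξ‖ ^ 2 : ℝ) : ℂ) * v t ξ l - nonlin (v t) (v t) ξ l + b t ξ l) (Icc 0 T) t := by
  have := hasDerivWithinAt_pi.1 (h.hasDerivWithinAt hc hT ha ξ hb ht) l
  simpa [Complex.real_smul] using this

end Mild

/-! ### The bootstrap: square-dominated families of all orders (forced) -/

section Bootstrap

variable {B : ℕ → ℝ → EuclideanSpace ℝ ι → ι → ℂ}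

omit [DecidableEq ι] in
/-- A force whose components form square-dominated families is continuous in time on `[0, T]` at
every frequency (as a vector). [folklore] -/
private theorem continuousOn_force_of_isDomFamily {n : ℕ} (hB0 : B 0 = b)
    (hB : ∀ l, IsDomFamily T n (fun k t ξ => B k t ξ l)) (ξ : EuclideanSpace ℝ ι) :
    ContinuousOn (fun t => b t ξ) (Icc 0 T) := by
  rw [continuousOn_pi]
  intro l
  have := (hB l).cont 0 (Nat.zero_le _) ξ
  simpa only [hB0] using this

/-- **Time-derivative families of all orders (forced).** For `c ≥ 0`, `T > 0`, a datum of Sobolev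
class, a force `b` with a derivative tower `B` (`B 0 = b`, every component of `B` a square-dominated
family of order `n` on `[0, T]`: `∂ₜ B_k = B_{k+1}`) and an `IsSobolevMildForced` solution `v`:
there is a vector family `W₀ = v, W₁, …, W_n` all of whose components are square-dominated Fourier
families of order `n` on `[0, T]` (`∂ₜ W_k = W_{k+1}` within `[0, T]`), built by induction via
`∂ₜ v = -c‖ξ‖² v − N(v, v) + b` and the closure of square-dominated families under the heat
symbol, the nonlinearity and addition of the force family (Tao 2011, Thm. 5.4 (iv) with force:
`∂ₜʲ u ∈ L^∞_t H^k_x` for all `j, k`; Leray 1934, pp. 220–221). [cite: Tao2011, Thm. 5.4 (iv) (arXiv Thm. 31)] -/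
theorem IsSobolevMildForced.exists_family (h : IsSobolevMildForced c T a b v) (hc : 0 ≤ c)
    (hT : 0 < T) (ha : IsSobolevFourierDatum a) (n : ℕ) (hB0 : B 0 = b)
    (hB : ∀ l, IsDomFamily T n (fun k t ξ => B k t ξ l)) :
    ∃ W : ℕ → ℝ → EuclideanSpace ℝ ι → ι → ℂ, W 0 = v ∧
      ∀ l, IsDomFamily T n (fun k t ξ => W k t ξ l) := by
  have base : ∀ l, IsDomFamily T 0 (fun _ t ξ => v t ξ l) := fun l => h.isDomFamily_zero hc ha l
  have hbcont : ∀ ξ, ContinuousOn (fun t => b t ξ) (Icc 0 T) :=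
    continuousOn_force_of_isDomFamily hB0 hB
  -- induction on the order `m ≤ n` (the force tower is used up to order `m - 1 ≤ n`)
  suffices hmain : ∀ m ≤ n, ∃ W : ℕ → ℝ → EuclideanSpace ℝ ι → ι → ℂ, W 0 = v ∧
      ∀ l, IsDomFamily T m (fun k t ξ => W k t ξ l) from hmain n le_rfl
  intro m
  induction m with
  | zero => exact fun _ => ⟨fun _ => v, rfl, base⟩
  | succ m ih =>
    intro hm
    obtain ⟨W, hW0, hW⟩ := ih (Nat.le_of_succ_le hm)
    -- the force tower restricted to order `m`
    have hBm : ∀ l, IsDomFamily T m (fun k t ξ => B k t ξ l) := fun l =>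
      (hB l).mono (Nat.le_of_succ_le hm)
    -- the right-hand side family `D_k = -c‖ξ‖² W_k − N(W, W)_k + B_k`
    set D : ℕ → ℝ → EuclideanSpace ℝ ι → ι → ℂ := fun k t ξ l =>
      -((c * ‖ξ‖ ^ 2 : ℝ) : ℂ) * W k t ξ l - nonlinFamily W W k t ξ l + B k t ξ l with hD
    have hD_fam : ∀ l, IsDomFamily T m (fun k t ξ => D k t ξ l) := fun l => by
      have h1 : IsDomFamily T m (fun k t ξ => -((c * ‖ξ‖ ^ 2 : ℝ) : ℂ) * W k t ξ l) :=
        (hW l).symbol (m := fun ξ => -((c * ‖ξ‖ ^ 2 : ℝ) : ℂ))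
          (by fun_prop : Continuous fun ξ : EuclideanSpace ℝ ι =>
            -((c * ‖ξ‖ ^ 2 : ℝ) : ℂ)).aestronglyMeasurable (d := 2) (M := c) hc
          (norm_heatSymbol_le hc)
      have h2 : IsDomFamily T m (fun k t ξ => nonlinFamily W W k t ξ l) :=
        (IsDomFamily.nonlinFamily hT hW hW l).isDomFamily
      exact (h1.sub h2).add (hBm l)
    refine ⟨consFamily v D, rfl, fun l => ?_⟩
    refine ⟨fun k hk t ht => ?_, fun k hk K => ?_, fun k hk ξ => ?_, fun k hk ξ t ht => ?_⟩
    · cases k with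
      | zero => exact (base l).meas 0 le_rfl t ht
      | succ k => exact (hD_fam l).meas k (by omega) t ht
    · cases k with
      | zero => exact (base l).dom 0 le_rfl K
      | succ k => exact (hD_fam l).dom k (by omega) K
    · cases k with
      | zero => exact (base l).cont 0 le_rfl ξ
      | succ k => exact (hD_fam l).cont k (by omega) ξ
    · cases k with
      | zero =>
        have hd := h.hasDerivWithinAt_apply hc hT.le ha ξ (hbcont ξ) ht l
        simp only [consFamily_zero, consFamily_succ, zero_add]
        convert hd using 1
        simp only [hD, hW0, nonlinFamily_zero, hB0]
      | succ k =>
        simp only [consFamily_succ]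
        exact (hD_fam l).deriv k (by omega) ξ t ht

/-- **Pressure families of all orders (projected force)**: with `W` as in `exists_family`, the
pressure symbol family `presFamily W W` is a (pointwise-decaying) Fourier family of order `n` with
zeroth member `presSymbol (v t) (v t)` — for a divergence-free force the pressure solves
`-Δp = ∇·∇·(u ⊗ u)` exactly as in the unforced case. [cite: Tao2011, Thm. 5.4 (iv) (arXiv Thm. 31), (9)] -/
theorem IsSobolevMildForced.exists_presFamily (h : IsSobolevMildForced c T a b v) (hc : 0 ≤ c)
    (hT : 0 < T) (ha : IsSobolevFourierDatum a) (n : ℕ) (hB0 : B 0 = b)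
    (hB : ∀ l, IsDomFamily T n (fun k t ξ => B k t ξ l)) :
    ∃ Q : ℕ → ℝ → EuclideanSpace ℝ ι → ℂ,
      (∀ t ξ, Q 0 t ξ = presSymbol (v t) (v t) ξ) ∧ IsFourierFamily T n Q := by
  obtain ⟨W, hW0, hW⟩ := h.exists_family hc hT ha n hB0 hB
  refine ⟨presFamily W W, fun t ξ => ?_, IsDomFamily.presFamily hT hW hW⟩
  rw [presFamily_zero, hW0]

/-- **The nonlinearity along a forced mild solution has families of all orders** (pointwise
decaying): `nonlinFamily W W` with zeroth member `N(v t, v t)`. [cite: Tao2011, Thm. 5.4 (iv) (arXiv Thm. 31)] -/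
theorem IsSobolevMildForced.exists_nonlinFamily (h : IsSobolevMildForced c T a b v) (hc : 0 ≤ c)
    (hT : 0 < T) (ha : IsSobolevFourierDatum a) (n : ℕ) (hB0 : B 0 = b)
    (hB : ∀ l, IsDomFamily T n (fun k t ξ => B k t ξ l)) :
    ∃ M : ℕ → ℝ → EuclideanSpace ℝ ι → ι → ℂ,
      (∀ t ξ, M 0 t ξ = nonlin (v t) (v t) ξ) ∧
        ∀ l, IsFourierFamily T n (fun k t ξ => M k t ξ l) := by
  obtain ⟨W, hW0, hW⟩ := h.exists_family hc hT ha n hB0 hB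
  refine ⟨nonlinFamily W W, fun t ξ => ?_, fun l => IsDomFamily.nonlinFamily hT hW hW l⟩
  rw [nonlinFamily_zero, hW0]

end Bootstrap

end Literature.Analysis.FluidPDE.FourierNS

end
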